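import Literature.NumberTheory.LFunctions.KowalskiMichelPeterssonBoundWeilFree
import Literature.NumberTheory.LFunctions.KowalskiMichelPeterssonNewformExpansion
import Literature.NumberTheory.ModularForms.PoincareSeriesWeightTwoHecke
import Literature.NumberTheory.ModularForms.PoincareSeriesWeightTwoHeckeConvergence
import Literature.NumberTheory.ModularForms.PoincareSeriesWeightTwoFourierModes
import Literature.NumberTheory.ModularForms.PoincareSeriesWeightTwoHeckeLimit
import Literature.NumberTheory.ModularForms.PoincareSeriesWeightTwoHeckeUnfolding
import Literature.NumberTheory.ModularForms.PoincareSeriesWeightTwoCuspFormOfL2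
import Literature.NumberTheory.ModularForms.PoincareSeriesWeightTwoHeckeAssembly
import Literature.NumberTheory.ModularForms.PoincareSeriesWeightTwoL2OfDominated
import HarnessLib

/-!
# Kowalski–Michel 2000 — Petersson's formula REDUCED to the `L²` step AT PRIME LEVEL (pointwise assembly)

`KowalskiMichelPeterssonFormulaOfHeckeL2` reduces the printed Petersson formula
`kowalskiMichel2000_peterssonFormula` ([KM00, §2.4.2 p. 312]) to the `L²`-convergence step of Hecke's
trick for the weight-2 Poincaré series stated at EVERY level `N`.  Since the printed formula is a
statement at PRIME level only, this file records the sharper bookkeeping: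

* `poincareAssembly_at` — the assembly `T1 → T3 → U → T4 → T5 → PoincareExists` of
  `PoincareSeriesWeightTwoHeckeAssembly.poincareAssembly`, POINTWISE in the level `N` and the index `m`
  (same proof; the landed theorem quantifies every hypothesis over all levels);
* `poincareExists_at_of_heckeL2_at` — at a fixed level `N` and `m ≥ 1`, the `L²` step alone gives the
  Poincaré cusp form with its printed coefficients and reproducing property (T1, T3, U, T5 are theorems);
* `heckeL2_at_of_domination_at` — at a fixed level, the `L²` step follows from continuity of Hecke's
  family, its square-integrability for each `s > 0`, and ONE integrable majorant of its Petersson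
  square-integrands on `𝒟` uniform in `0 < s ≤ 1` (dominated convergence, `heckeL2_of_dominated`);
* `peterssonFormula_of_poincareExists_prime`, `peterssonFormula_of_heckeL2_prime`,
  `peterssonFormula_of_heckeDomination_prime` — the printed formula from the corresponding input AT PRIME
  LEVELS ONLY.

So a proof of the `L²` step (or of the uniform domination) at prime level closes the printed formula.
-/

noncomputable section

open scoped MatrixGroups Real ModularForm Topology Manifold
open CongruenceSubgroup Complex MeasureTheory Set Filter
open UpperHalfPlane hiding I
open Literature.NumberTheory.EllipticCurves.ModularForms

namespace Literature.NumberTheory.ModularForms.PoincareWeightTwo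

/-- A `q`-series `Σ aₙ e(z)ⁿ` with `|aₙ| ≤ C (n+1)ᵏ` converges at every `z ∈ ℍ` (copy of the private
lemma of `PoincareSeriesWeightTwoHeckeAssembly`). [folklore] -/
private theorem summable_qSeries' {a : ℕ → ℂ} {C : ℝ} {k : ℕ} (ha : ∀ n, ‖a n‖ ≤ C * ((n : ℝ) + 1) ^ k)
    (τ : ℍ) : Summable fun n ↦ a n * cexp (2 * π * Complex.I * τ) ^ n := by
  set r : ℝ := ‖cexp (2 * π * Complex.I * τ)‖ with hr
  have hrpos : 0 < r := norm_pos_iff.mpr (Complex.exp_ne_zero _)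
  have hr1 : r < 1 := by
    rw [hr, Complex.norm_exp]
    refine Real.exp_lt_one_iff.mpr ?_
    have : (2 * π * Complex.I * τ).re = -2 * π * τ.im := by
      simp [Complex.mul_re, Complex.mul_im]
    rw [this]
    nlinarith [Real.pi_pos, τ.im_pos]
  have h1 : Summable fun n : ℕ ↦ ((n : ℝ)) ^ k * r ^ n :=
    summable_pow_mul_geometric_of_norm_lt_one k (by rwa [Real.norm_of_nonneg hrpos.le])
  have h2 := (summable_nat_add_iff 1).mpr h1
  have hM : Summable fun n : ℕ ↦ C * ((n : ℝ) + 1) ^ k * r ^ n := by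
    refine ((h2.mul_left (C * r⁻¹))).congr fun n ↦ ?_
    simp only [Nat.cast_add, Nat.cast_one, pow_succ]
    field_simp
  refine Summable.of_norm_bounded hM fun n ↦ ?_
  rw [norm_mul, norm_pow]
  exact mul_le_mul_of_nonneg_right (ha n) (pow_nonneg hrpos.le n)

/-- **Pointwise assembly** (Iwaniec–Kowalski Lemmas 14.2–14.3 at `k = 2`, Hecke's trick), at a FIXED
level `N` and index `m ≥ 1`: convergence + weight-`(2,s)` automorphy of `P_m(·,s)` for `s > 0` (T1), the
pointwise limit `P_m(·,s) → Q_m` as `s → 0⁺` (T3), the unfolding identity against cusp forms (U), the `L²`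
statement (T4: `Q_m` and `yˢP_m(·,s)` Petersson-square-integrable, `‖yˢP_m(·,s) − Q_m‖ → 0`) and the
`L²`-holomorphic ⇒ cusp form principle at level `N` (T5) give `P ∈ S_2(Γ₀(N))` with `a_P(n) = p_m(n)`
(`n ≥ 1`) and `⟨P, f⟩ = a_f(m)/(4πm)` for all `f`.  The proof is that of `poincareAssembly`, verbatim.
[cite: IwaniecKowalski2004, Lemma 14.2 and Lemma 14.3 (k = 2, Hecke's trick §3.2)] -/
theorem poincareAssembly_at (N : ℕ) [NeZero N] {m : ℕ} (hm : 1 ≤ m)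
    (hT1 : ∀ (s : ℝ), 0 < s → ∀ z : ℍ,
      Summable (fun v : Row N ↦ poincareTerm N m s v z) ∧
      ∀ γ : SL(2, ℤ), γ ∈ Gamma0 N →
        poincareHecke N m s (γ • z) =
          (rowDenom ((γ : Matrix (Fin 2) (Fin 2) ℤ) 1) z) ^ 2 *
            ((‖rowDenom ((γ : Matrix (Fin 2) (Fin 2) ℤ) 1) z‖ ^ (2 * s) : ℝ) : ℂ) *
              poincareHecke N m s z)
    (hT3 : ∀ z : ℍ,
      Tendsto (fun s : ℝ ↦ poincareHecke N m s z) (𝓝[>] 0) (𝓝 (poincareQSeries N m z)))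
    (hU : ∀ (s : ℝ), 0 < s → ∀ f : CuspForm (Gamma0 N) 2,
      peterssonPairing N 2 (fun z : ℍ ↦ ((z.im ^ s : ℝ) : ℂ) * poincareHecke N m s z) ⇑f =
        ((Real.Gamma (s + 1) / (4 * π * m) ^ (s + 1) : ℝ) : ℂ) * cuspCoeff f m)
    (hT4 : PeterssonSqIntegrable N 2 (poincareQSeries N m) ∧
      (∀ s : ℝ, 0 < s →
        PeterssonSqIntegrable N 2 (fun z : ℍ ↦ ((z.im ^ s : ℝ) : ℂ) * poincareHecke N m s z)) ∧
      Tendsto (fun s : ℝ ↦ (peterssonPairing N 2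
          (fun z : ℍ ↦ ((z.im ^ s : ℝ) : ℂ) * poincareHecke N m s z - poincareQSeries N m z)
          (fun z : ℍ ↦ ((z.im ^ s : ℝ) : ℂ) * poincareHecke N m s z - poincareQSeries N m z)).re)
        (𝓝[>] 0) (𝓝 0))
    (hT5 : ∀ (g : ℍ → ℂ), MDifferentiable 𝓘(ℂ) 𝓘(ℂ) g →
      (∀ γ : SL(2, ℤ), γ ∈ Gamma0 N → ∀ z : ℍ,
        g (γ • z) = (rowDenom ((γ : Matrix (Fin 2) (Fin 2) ℤ) 1) z) ^ 2 * g z) →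
      PeterssonSqIntegrable N 2 g →
      ∃ f : CuspForm (Gamma0 N) 2, ∀ z : ℍ, f z = g z) :
    ∃ P : CuspForm (Gamma0 N) 2,
      (∀ n : ℕ, 1 ≤ n → cuspCoeff P n = poincareCoeff N m n) ∧
      (∀ f : CuspForm (Gamma0 N) 2,
        peterssonProduct (Gamma0 N) 2 P f = ((1 / (4 * π * m) : ℝ) : ℂ) * cuspCoeff f m) := by
  -- the limit `Q = Σ p_m(n) e(nz)`: holomorphic, weight-2 invariant, square-integrable ⇒ a cusp form
  have hQmd : MDifferentiable 𝓘(ℂ) 𝓘(ℂ) (poincareQSeries N m) := mdifferentiable_poincareQSeries N hm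
  have hQinv : ∀ γ : SL(2, ℤ), γ ∈ Gamma0 N → ∀ z : ℍ,
      poincareQSeries N m (γ • z) =
        (rowDenom ((γ : Matrix (Fin 2) (Fin 2) ℤ) 1) z) ^ 2 * poincareQSeries N m z :=
    fun γ hγ z ↦ poincareLimit_smul γ (fun s hs z ↦ (hT1 s hs z).2 γ hγ) hT3 z
  obtain ⟨hQsq, hGsq, hL2⟩ := hT4
  obtain ⟨P, hP⟩ := hT5 (poincareQSeries N m) hQmd hQinv hQsq
  have hPQ : (⇑P : ℍ → ℂ) = poincareQSeries N m := funext hP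
  refine ⟨P, fun n hn ↦ ?_, fun f ↦ ?_⟩
  · -- the coefficients, by uniqueness of the `q`-expansion
    have hΓ : (1 : ℝ) ∈ (Gamma0 N : Subgroup (GL (Fin 2) ℝ)).strictPeriods := by
      rw [strictPeriods_Gamma0]; exact AddSubgroup.mem_zmultiples 1
    obtain ⟨C, -, hC⟩ := norm_poincareCoeff_le_pow
    have hsum : ∀ τ : ℍ, HasSum (fun n : ℕ ↦ (if n = 0 then (0 : ℂ) else poincareCoeff N m n) •
        Function.Periodic.qParam 1 (τ : ℂ) ^ n) (P τ) := by
      intro τ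
      rw [hP τ, poincareQSeries_eq_qSeries]
      have hq : Function.Periodic.qParam 1 (τ : ℂ) = cexp (2 * π * Complex.I * τ) := by
        rw [Function.Periodic.qParam]; congr 1; push_cast; ring
      simp_rw [hq, smul_eq_mul]
      exact (summable_qSeries' (fun n ↦ hC N m hm n) τ).hasSum
    have huniq := ModularFormClass.qExpansion_coeff_unique one_pos hΓ (f := P) hsum n
    rw [cuspCoeff, ← huniq, if_neg (by omega)]
  · -- the reproducing property: `⟨P, f⟩ = lim_{s→0⁺} ⟨yˢP_m(·,s), f⟩ = a_f(m)/(4πm)`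
    have hm0 : (0 : ℝ) < 4 * π * m := by
      have : (1 : ℝ) ≤ m := by exact_mod_cast hm
      positivity
    -- (i) the unfolding identity tends to `a_f(m)/(4πm)`
    have hlim1 : Tendsto (fun s : ℝ ↦ peterssonPairing N 2
        (fun z : ℍ ↦ ((z.im ^ s : ℝ) : ℂ) * poincareHecke N m s z) ⇑f) (𝓝[>] 0)
        (𝓝 (((1 / (4 * π * m) : ℝ) : ℂ) * cuspCoeff f m)) := by
      have h := ((Complex.continuous_ofReal.tendsto _).comp (tendsto_Gamma_div_rpow hm)).mul
        (tendsto_const_nhds (x := cuspCoeff f m))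
      refine h.congr' ?_
      filter_upwards [self_mem_nhdsWithin] with s hs
      exact (hU s hs f).symm
    -- (ii) the `L²` limit: `⟨yˢP_m(·,s), f⟩ → ⟨Q, f⟩` (Cauchy–Schwarz)
    have hQm : Measurable (poincareQSeries N m) := hQmd.continuous.measurable
    have hfm : Measurable (⇑f : ℍ → ℂ) := (ModularFormClass.holo f).continuous.measurable
    have hfsq : PeterssonSqIntegrable N 2 ⇑f := peterssonSqIntegrable_coe N 2 f
    have hGm : ∀ s : ℝ, 0 < s →
        Measurable (fun z : ℍ ↦ ((z.im ^ s : ℝ) : ℂ) * poincareHecke N m s z) := fun s hs ↦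
      (Complex.measurable_ofReal.comp (UpperHalfPlane.continuous_im.measurable.pow_const s)).mul
        (measurable_poincareHecke m hs)
    have hlim2 : Tendsto (fun s : ℝ ↦ peterssonPairing N 2
        (fun z : ℍ ↦ ((z.im ^ s : ℝ) : ℂ) * poincareHecke N m s z) ⇑f) (𝓝[>] 0)
        (𝓝 (peterssonPairing N 2 (poincareQSeries N m) ⇑f)) := by
      rw [← tendsto_sub_nhds_zero_iff]
      refine squeeze_zero_norm' (a := fun s ↦ Real.sqrt ((peterssonPairing N 2
          (fun z : ℍ ↦ ((z.im ^ s : ℝ) : ℂ) * poincareHecke N m s z - poincareQSeries N m z)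
          (fun z : ℍ ↦ ((z.im ^ s : ℝ) : ℂ) * poincareHecke N m s z - poincareQSeries N m z)).re) *
          Real.sqrt ((peterssonPairing N 2 ⇑f ⇑f).re)) ?_ ?_
      · filter_upwards [self_mem_nhdsWithin] with s hs
        rw [← peterssonPairing_sub_left _ _ _
          (integrableOn_sum_petersson _ _ (hGm s hs) hfm (hGsq s hs) hfsq)
          (integrableOn_sum_petersson _ _ hQm hfm hQsq hfsq)]
        exact norm_peterssonPairing_le _ _
          (peterssonSqIntegrable_sub _ _ (hGm s hs) hQm (hGsq s hs) hQsq) hfsq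
      · have h0 := (Real.continuous_sqrt.tendsto 0).comp hL2
        rw [Function.comp_def, Real.sqrt_zero] at h0
        simpa using h0.mul (tendsto_const_nhds (x := Real.sqrt ((peterssonPairing N 2 ⇑f ⇑f).re)))
    have heq : peterssonPairing N 2 (poincareQSeries N m) ⇑f = ((1 / (4 * π * m) : ℝ) : ℂ) * cuspCoeff f m :=
      tendsto_nhds_unique hlim2 hlim1
    rw [← peterssonPairing_coe_eq, hPQ, heq]

/-- **The Poincaré cusp form at a fixed level from the `L²` step alone.** At level `N` and `m ≥ 1`, if
`Q_m` and `yˢP_m(·,s)` (`s > 0`) are Petersson-square-integrable and `‖yˢP_m(·,s) − Q_m‖² → 0` as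
`s → 0⁺`, then there is `P ∈ S_2(Γ₀(N))` with coefficients `p_m(n) = δ(m,n) − √(n/m)·J_N(m,n)` and
`⟨P, f⟩ = a_f(m)/(4πm)`; the other inputs of `poincareAssembly_at` are the theorems `heckeConvergence`,
`heckeLimit_of_fourierModes heckeFourierModes`, `heckeUnfolding`, `cuspFormOfL2`.
[cite: IwaniecKowalski2004, Lemma 14.2, Lemma 14.3 and the remark after (14.13), k = 2] -/
theorem poincareExists_at_of_heckeL2_at (N : ℕ) [NeZero N] {m : ℕ} (hm : 1 ≤ m)
    (hT4 : PeterssonSqIntegrable N 2 (poincareQSeries N m) ∧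
      (∀ s : ℝ, 0 < s →
        PeterssonSqIntegrable N 2 (fun z : ℍ ↦ ((z.im ^ s : ℝ) : ℂ) * poincareHecke N m s z)) ∧
      Tendsto (fun s : ℝ ↦ (peterssonPairing N 2
          (fun z : ℍ ↦ ((z.im ^ s : ℝ) : ℂ) * poincareHecke N m s z - poincareQSeries N m z)
          (fun z : ℍ ↦ ((z.im ^ s : ℝ) : ℂ) * poincareHecke N m s z - poincareQSeries N m z)).re)
        (𝓝[>] 0) (𝓝 0)) :
    ∃ P : CuspForm (Gamma0 N) 2,
      (∀ n : ℕ, 1 ≤ n → cuspCoeff P n = poincareCoeff N m n) ∧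
      (∀ f : CuspForm (Gamma0 N) 2,
        peterssonProduct (Gamma0 N) 2 P f = ((1 / (4 * π * m) : ℝ) : ℂ) * cuspCoeff f m) :=
  poincareAssembly_at N hm (fun s hs z ↦ heckeConvergence N m hm s hs z)
    (heckeLimit_of_fourierModes heckeFourierModes N m hm) (fun s hs f ↦ heckeUnfolding N m hm s hs f)
    hT4 (fun g ↦ cuspFormOfL2 N g)

/-- **The `L²` step at a fixed level from uniform domination** (dominated convergence): if Hecke's family
`E_s = yˢP_m(·,s)` is continuous for `0 < s ≤ 1`, Petersson-square-integrable for every `s > 0`, and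
its Petersson square-integrands `Σ_q |E_s(q⁻¹τ)|² (Im q⁻¹τ)²` on `𝒟` are dominated by one integrable
`G` uniformly in `0 < s ≤ 1`, then `Q_m` is square-integrable and `‖E_s − Q_m‖² → 0` (`s → 0⁺`); the
pointwise limit `E_s → Q_m` is the theorem `heckeLimit_of_fourierModes` (with `yˢ → 1`) and `Q_m` is
continuous (`mdifferentiable_poincareQSeries`). [cite: IwaniecKowalski2004, §14.2, remark after (14.13) (k = 2)] -/
theorem heckeL2_at_of_domination_at (N : ℕ) [NeZero N] {m : ℕ} (hm : 1 ≤ m)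
    (hcont : ∀ s : ℝ, 0 < s → s ≤ 1 →
      Continuous (fun z : ℍ ↦ ((z.im ^ s : ℝ) : ℂ) * poincareHecke N m s z))
    (hsq : ∀ s : ℝ, 0 < s →
      PeterssonSqIntegrable N 2 (fun z : ℍ ↦ ((z.im ^ s : ℝ) : ℂ) * poincareHecke N m s z))
    (hdom : ∃ G : ℍ → ℝ, IntegrableOn G ModularGroup.fd ∧
      letI := Fintype.ofFinite (𝒮ℒ ⧸ (Gamma0 N : Subgroup (GL (Fin 2) ℝ)).subgroupOf 𝒮ℒ)
      ∀ s : ℝ, 0 < s → s ≤ 1 → ∀ τ ∈ ModularGroup.fd,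
        ∑ q : 𝒮ℒ ⧸ (Gamma0 N : Subgroup (GL (Fin 2) ℝ)).subgroupOf 𝒮ℒ,
          ‖(fun z : ℍ ↦ ((z.im ^ s : ℝ) : ℂ) * poincareHecke N m s z)
              (((q.out : 𝒮ℒ) : GL (Fin 2) ℝ)⁻¹ • τ)‖ ^ 2 *
            ((((q.out : 𝒮ℒ) : GL (Fin 2) ℝ)⁻¹ • τ).im) ^ (2 : ℤ) ≤ G τ) :
    PeterssonSqIntegrable N 2 (poincareQSeries N m) ∧
      (∀ s : ℝ, 0 < s →
        PeterssonSqIntegrable N 2 (fun z : ℍ ↦ ((z.im ^ s : ℝ) : ℂ) * poincareHecke N m s z)) ∧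
      Tendsto (fun s : ℝ ↦ (peterssonPairing N 2
          (fun z : ℍ ↦ ((z.im ^ s : ℝ) : ℂ) * poincareHecke N m s z - poincareQSeries N m z)
          (fun z : ℍ ↦ ((z.im ^ s : ℝ) : ℂ) * poincareHecke N m s z - poincareQSeries N m z)).re)
        (𝓝[>] 0) (𝓝 0) := by
  obtain ⟨G, hG, hdom⟩ := hdom
  have hlim := heckeLimit_of_fourierModes heckeFourierModes N m hm
  have hQ : Continuous (poincareQSeries N m) := (mdifferentiable_poincareQSeries N hm).continuous
  -- `yˢ P_m(z,s) → Q(z)` (since `yˢ → 1`)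
  have hlimE : ∀ z : ℍ, Tendsto (fun s : ℝ ↦ ((z.im ^ s : ℝ) : ℂ) * poincareHecke N m s z)
      (𝓝[>] 0) (𝓝 (poincareQSeries N m z)) := by
    intro z
    have hy : Tendsto (fun s : ℝ ↦ ((z.im ^ s : ℝ) : ℂ)) (𝓝[>] 0) (𝓝 1) := by
      have hc : Continuous fun s : ℝ ↦ ((z.im ^ s : ℝ) : ℂ) :=
        Complex.continuous_ofReal.comp (Real.continuous_const_rpow z.im_pos.ne')
      have h1 : (((z.im ^ (0 : ℝ) : ℝ)) : ℂ) = 1 := by simp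
      rw [← h1]
      exact (hc.tendsto 0).mono_left nhdsWithin_le_nhds
    simpa using hy.mul (hlim z)
  obtain ⟨ha, -, hc⟩ := heckeL2_of_dominated (N := N)
    (fun (s : ℝ) (z : ℍ) ↦ ((z.im ^ s : ℝ) : ℂ) * poincareHecke N m s z) (poincareQSeries N m) G
    hcont hQ hG hdom hlimE
  exact ⟨ha, hsq, hc⟩

end Literature.NumberTheory.ModularForms.PoincareWeightTwo

namespace Literature.NumberTheory.LFunctions.KowalskiMichel2000

open Literature.NumberTheory.ModularForms.PoincareWeightTwo

/-- **Kowalski–Michel 2000, §2.4.2 p. 312 — Petersson's formula from the Poincaré cusp forms AT PRIME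
LEVEL.** If for every prime `q` and `l₁ ≥ 1` there is `P ∈ S_2(Γ₀(q))` with coefficients
`a_P(n) = δ(l₁,n) − √(n/l₁)·J_q(l₁,n)` and `⟨P, f⟩ = a_f(l₁)/(4πl₁)`, then the printed formula holds:
the newform Parseval step (`cuspCoeff_eq_mul_pet_of_peterssonProduct_eq`, `c = 1/(4πl₁)`) gives
`√(l₂/l₁)·Δ_q(l₁,l₂) = a_P(l₂) = δ(l₁,l₂) − √(l₂/l₁)·J_q(l₁,l₂)`; divide by `√(l₂/l₁) > 0`.
[cite: KowalskiMichel2000, §2.4.2 p. 312 (Petersson's formula)] -/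
theorem peterssonFormula_of_poincareExists_prime
    (hE : ∀ (q : ℕ) [NeZero q], q.Prime → ∀ (m : ℕ), 1 ≤ m → ∃ P : CuspForm (Gamma0 q) 2,
      (∀ n : ℕ, 1 ≤ n → cuspCoeff P n = poincareCoeff q m n) ∧
      (∀ f : CuspForm (Gamma0 q) 2,
        peterssonProduct (Gamma0 q) 2 P f = ((1 / (4 * π * m) : ℝ) : ℂ) * cuspCoeff f m)) :
    kowalskiMichel2000_peterssonFormula := by
  rw [peterssonFormula_iff_identity]
  intro q _ hq l₁ l₂ h₁' h₂'
  obtain ⟨P, hP, hrep⟩ := hE q hq l₁ h₁'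
  have hA := cuspCoeff_eq_mul_pet_of_peterssonProduct_eq hq h₁' h₂' P (1 / (4 * π * l₁)) hrep
  have hB := hP l₂ h₂'
  rw [poincareCoeff] at hB
  have hl₁ : (0 : ℝ) < l₁ := by exact_mod_cast h₁'
  have hl₂ : (0 : ℝ) < l₂ := by exact_mod_cast h₂'
  have hρ : 1 / (4 * π * (l₁ : ℝ)) * (4 * π * Real.sqrt ((l₁ : ℝ) * l₂)) =
      Real.sqrt l₂ / Real.sqrt l₁ := by
    rw [Real.sqrt_mul hl₁.le]
    have h1 : Real.sqrt (l₁ : ℝ) ≠ 0 := (Real.sqrt_pos.mpr hl₁).ne'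
    have h1' : (Real.sqrt (l₁ : ℝ)) ^ 2 = l₁ := Real.sq_sqrt hl₁.le
    field_simp
    nlinarith [h1', Real.pi_pos]
  have hρpos : 0 < Real.sqrt (l₂ : ℝ) / Real.sqrt l₁ :=
    div_pos (Real.sqrt_pos.mpr hl₂) (Real.sqrt_pos.mpr hl₁)
  set ρ : ℝ := Real.sqrt (l₂ : ℝ) / Real.sqrt l₁ with hρdef
  rw [hρ] at hA
  have hρC : (ρ : ℂ) ≠ 0 := by exact_mod_cast hρpos.ne'
  have key : (ρ : ℂ) * pet q l₁ l₂ = (if l₁ = l₂ then 1 else 0) - (ρ : ℂ) * petJ q l₁ l₂ :=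
    hA.symm.trans hB
  by_cases h : l₁ = l₂
  · subst h
    have hρ1 : ρ = 1 := by rw [hρdef]; exact div_self (Real.sqrt_pos.mpr hl₁).ne'
    simpa [hρ1] using key
  · rw [if_neg h] at key ⊢
    have : (ρ : ℂ) * pet q l₁ l₂ = (ρ : ℂ) * (0 - petJ q l₁ l₂) := by rw [key]; ring
    exact mul_left_cancel₀ hρC this

/-- **Kowalski–Michel 2000, §2.4.2 p. 312 — Petersson's formula from the `L²` step AT PRIME LEVELS.**
If for every prime `q` and `m ≥ 1` the `q`-series `Q_m` and Hecke's family `yˢP_m(·,s)` of level `q` are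
Petersson-square-integrable with `‖yˢP_m(·,s) − Q_m‖² → 0` (`s → 0⁺`), the printed Petersson formula
holds (`poincareExists_at_of_heckeL2_at` + `peterssonFormula_of_poincareExists_prime`).
[cite: KowalskiMichel2000, §2.4.2 p. 312 (Petersson's formula); IwaniecKowalski2004, §14.2 (k = 2)] -/
theorem peterssonFormula_of_heckeL2_prime
    (hT4 : ∀ (q : ℕ) [NeZero q], q.Prime → ∀ (m : ℕ), 1 ≤ m →
      PeterssonSqIntegrable q 2 (poincareQSeries q m) ∧
      (∀ s : ℝ, 0 < s →
        PeterssonSqIntegrable q 2 (fun z : ℍ ↦ ((z.im ^ s : ℝ) : ℂ) * poincareHecke q m s z)) ∧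
      Tendsto (fun s : ℝ ↦ (peterssonPairing q 2
          (fun z : ℍ ↦ ((z.im ^ s : ℝ) : ℂ) * poincareHecke q m s z - poincareQSeries q m z)
          (fun z : ℍ ↦ ((z.im ^ s : ℝ) : ℂ) * poincareHecke q m s z - poincareQSeries q m z)).re)
        (𝓝[>] 0) (𝓝 0)) :
    kowalskiMichel2000_peterssonFormula :=
  peterssonFormula_of_poincareExists_prime fun q _ hq _ hm ↦
    poincareExists_at_of_heckeL2_at q hm (hT4 q hq _ hm)

/-- **Kowalski–Michel 2000, §2.4.2 p. 312 — Petersson's formula from UNIFORM DOMINATION AT PRIME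
LEVELS.** If for every prime `q` and `m ≥ 1` Hecke's family `E_s = yˢP_m(·,s)` of level `q` is continuous
(`0 < s ≤ 1`), Petersson-square-integrable (`s > 0`), and its Petersson square-integrands on `𝒟` admit
one integrable majorant uniformly in `0 < s ≤ 1`, the printed Petersson formula holds
(`heckeL2_at_of_domination_at` + `peterssonFormula_of_heckeL2_prime`).
[cite: KowalskiMichel2000, §2.4.2 p. 312 (Petersson's formula); IwaniecKowalski2004, §14.2 (k = 2)] -/
theorem peterssonFormula_of_heckeDomination_prime
    (hD : ∀ (q : ℕ) [NeZero q], q.Prime → ∀ (m : ℕ), 1 ≤ m →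
      (∀ s : ℝ, 0 < s → s ≤ 1 →
        Continuous (fun z : ℍ ↦ ((z.im ^ s : ℝ) : ℂ) * poincareHecke q m s z)) ∧
      (∀ s : ℝ, 0 < s →
        PeterssonSqIntegrable q 2 (fun z : ℍ ↦ ((z.im ^ s : ℝ) : ℂ) * poincareHecke q m s z)) ∧
      ∃ G : ℍ → ℝ, IntegrableOn G ModularGroup.fd ∧
        letI := Fintype.ofFinite (𝒮ℒ ⧸ (Gamma0 q : Subgroup (GL (Fin 2) ℝ)).subgroupOf 𝒮ℒ)
        ∀ s : ℝ, 0 < s → s ≤ 1 → ∀ τ ∈ ModularGroup.fd,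
          ∑ r : 𝒮ℒ ⧸ (Gamma0 q : Subgroup (GL (Fin 2) ℝ)).subgroupOf 𝒮ℒ,
            ‖(fun z : ℍ ↦ ((z.im ^ s : ℝ) : ℂ) * poincareHecke q m s z)
                (((r.out : 𝒮ℒ) : GL (Fin 2) ℝ)⁻¹ • τ)‖ ^ 2 *
              ((((r.out : 𝒮ℒ) : GL (Fin 2) ℝ)⁻¹ • τ).im) ^ (2 : ℤ) ≤ G τ) :
    kowalskiMichel2000_peterssonFormula :=
  peterssonFormula_of_heckeL2_prime fun q _ hq _ hm ↦ by
    obtain ⟨hcont, hsq, hdom⟩ := hD q hq _ hm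
    exact heckeL2_at_of_domination_at q hm hcont hsq hdom

end Literature.NumberTheory.LFunctions.KowalskiMichel2000

end
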